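/-
Copyright (c) 2026 the pub-hodgecm-mathlib formalisation cell (harness21).  Prover seat hodgecm-mathlib-LH7-p05 (g2) on the CHAIR K2-lead VALVE,
Track B «K2-LIT» ∕ hLiu418 #184♮ = `stmt-HodgeConjecture-24832`, Road I v3 U5 «THE CLOSE» — #42F′ ED. 7 hol-cut letter (LEAD F0P6-plan (g14)
RULING M-158n (Q1) + BATCH #99 (3); desk K2Liu-p02 (g8) + K2Liu-p10 (g6)).  DEF LANE: two definitions + two abbreviations + `rfl`∕`simp`∕by-name API.
-/
import Literature.NumberTheory.GelbartRogawski1991.DoubledWeilRepresentationArchVacuum   -- ★ `frameD` (the scaled Folland frame of the doubled archimedean space), `sectionD`, `omega_archHalfOf_gaussian_tmul`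
import Literature.NumberTheory.K2Lit.DoubledTensorEmbedding                               -- ★ `tensorFrame`, `tensorFrame_real`, `tensorFrame_ne_zero` (the BIG doubled datum of #42F′)
import Literature.NumberTheory.K2Lit.SiegelStandardSections                                -- ★ `IwasawaDatum` (the #42F′ face prefix, tie-ready cut only)
import Literature.NumberTheory.Automorphic.ConjugateSelfDualCharacters                     -- ★ `IsConjugateSymplectic` (idem)
import Literature.NumberTheory.Automorphic.UnitaryGroupAdelicCenter                          -- ★ `UnitaryGroup.adelicOne` (idem)
import HarnessLib

/-!
# K2_Liu road (hLiu418), #42F′ ED. 7: THE ARCHIMEDEAN GAUSSIAN `v_G` OF THE DOUBLED WEIL REPRESENTATION AS A TREE TERM, AND THE HOL-CUT `HL_rec V₀ :⟺ V₀ = ℂ ∙ v_G`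

Cell `pub/hodgecm-mathlib` (D-0151), Track B, build stream 29; namespace `Summit.HodgeConjecture.HodgeConjecture.Cruxes.HLiu418.K2LiuArchGaussianOfRecord`.
DEFINITIONS + API ONLY (no theorem of [Liu2021] asserted, no instance, no notation, no named-fact hypothesis, no `sorry`).

WHY (RULING M-158n (Q1), BATCH #99 (3), BATCH #101 (5)).  ED. 7 of the #42F′ TOP `firstTermIdentityOnGenerators_of_holCut (HL : … → Submodule ℂ 𝓢(…) → Prop) …`
is PREDICATE-PARAMETRIC in the hol-cut `HL`; its two payers instantiate `HL := HL_rec` at the tie, where `HL_rec V₀ :⟺ V₀ = ℂ ∙ v_G` and `v_G` is the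
archimedean GAUSSIAN (Folland–Fock vacuum) of the BIG doubled Weil representation `ω_{χb}` of `(U(𝔻), U(V′))` on `𝓢((Fin (n′+n′) → L⁺ ⊗ ℝ), ℂ)`.  Until now the
tree carried this vector only BY VALUE — `follandHermite (frameD …) 0` inside ★ `GRConstruction.omega_archHalfOf_gaussian_tmul`, ★ `schwartzReindexCLM_archBoxTensor_gaussianV`,
★ `vac_sectionD_archK` (one copy is named: ★ `gaussianV`).  This file NAMES it and the cut:
* §1 (generic doubled datum `(e, dV, dW)` of ★ `DoubledUnitaryGlobalSplittingData`): `archGaussian := follandHermite (frameD …) 0` (**`v_G`**) with the byte guard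
  `archGaussian_eq_follandHermite` (`rfl`); `HLrec V₀ := V₀ = ℂ ∙ archGaussian …` (**`HL_rec`**; Mathlib `∙` = `Submodule.span ℂ {·}`) with the byte guards `hLrec_iff`
  (`Iff.rfl`) and `hLrec_span` (`rfl`: the Gaussian line satisfies the cut).
* §2 (the #42F′ instance, ★ p862586 :111∕:206 = the case `N = 2, M = 1, M₂ = 3`): `archGaussianOfRecord` ∕ `HLrecOfRecord` := §1 at the BIG datum
  `(e′, dV, tensorFrame L dW eW dV′)` of ★ `K2Lit.DoubledTensorEmbedding`, byte guards `archGaussianOfRecord_eq_follandHermite` (`rfl`), `hLrecOfRecord_iff` (`Iff.rfl`),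
  `hLrecOfRecord_span` (`rfl`); and the TIE-READY cut `holCutOfRecord` = the #42F′ face prefix of RULING M-158p (1) `(L) … (e) (dV hdV hdV0) (dW hdW hdW0) (lam hlam)
  (eW) (e′) (dV′ hdV′ hdV′0) (χb hχbu hχbs) (α hα hαrat) (𝒦)` VERBATIM (★ p862586 :96–108 letters; the vector depends on none of `e lam χb α 𝒦`) then `V₀ ↦ HLrecOfRecord … V₀`,
  byte guard `holCutOfRecord_iff` (`Iff.rfl`).  TIE: `HL := holCutOfRecord` if ED. 7's `HL` carries that ∀-list, else `HL := fun … => HLrecOfRecord …`.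
DEFS + `rfl`∕`Iff.rfl` BYTE GUARDS ONLY (LEAD BATCH #103 (2)); the THEOREM API (`archGaussian_apply` closed form `2^{|σ|∕4}·exp(−π Σ_s (frameD y)_s²)`, `archGaussian_ne_zero`,
`v_G = R_{e₂}(G_𝕍 ⊠ G_𝕍)`, the eigen-laws `ω(archHalfOf t k)(v_G ⊗ f) = (η_t(k)·vac(sectionD k)) • (v_G ⊗ f)` ∕ the same for ANY `IsDoubledWeilRep χ sD` at `(k, 1_f)`,
`finrank V₀ = 1` on the cut, `⊥` fails the cut) is GREEN in the HOME scratch `F0/P3c/LH7/LH7-p05/g2/gauss/K2LiuArchGaussianOfRecord.combined.scratch.v1.LH7p05g2.lean` and goes to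
the rows file `K2LiuFirstTermHolCutRows` (K2Liu-p27 (g2)) per BATCH #103 (1)–(2).
NOT HERE (proof lane, other hands): `harch (ℂ ∙ v_G)` through ★ `tensorEmb`; the (T)(L)(CR) holomorphic type of `T₁ (v_G ⊗ f)` (`hdet hP₁ hP₂` payer over ★ `K2LiuResidueMapHolType`).
HONEST LABEL: count-neutral def letter, `--supports stmt-HodgeConjecture-24832 --as helper`, closes nothing, moves no counter; HC_CM is proved only modulo the 7 printed
citations (2 remaining named inputs: hLiu418 = stmt-HodgeConjecture-24832, h413 = stmt-HodgeConjecture-24833) until rung 0 closes.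
References: [Folland1989] G. B. Folland, *Harmonic Analysis in Phase Space* (1989) §1.7 (1.81), §4.2 Prop. (4.39); [GelbartRogawski1991] Invent. Math. 105 (1991) §3.1
Prop. 3.1.1 p. 455; [Kudla1994] Israel J. Math. 87 (1994) §2, §3 Thm. 3.1; [HarrisKudlaSweet1996] J. AMS 9 (1996) §1 (1.9); [KonnoKonno2007] Kyushu J. Math. 61 (2007)
Lem. 5.2; [Paul1998] J. Funct. Anal. 159 (1998) §1.2 (1.2.1)–(1.2.2); [Liu2021] Camb. J. Math. 9 (2021) App. B proof of Prop. B.8.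
-/

set_option autoImplicit false
set_option linter.dupNamespace false -- the mandated namespace repeats `HodgeConjecture.HodgeConjecture`

noncomputable section

open scoped Classical SchwartzMap  -- `Classical`: the `Fintype`∕`DecidableEq` of the real places inside `mixedSpace (L⁺)` (as in ★ p862586)
open NumberField NumberField.InfinitePlace NumberField.mixedEmbedding
open Literature.NumberTheory.Automorphic Literature.NumberTheory.Automorphic.IdeleClassGroup Literature.NumberTheory.GaloisRepresentations
open Literature.NumberTheory.Weil1964 (follandHermite)
open Literature.NumberTheory.GelbartRogawski1991 Literature.NumberTheory.GelbartRogawski1991.GRConstruction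
open Literature.NumberTheory.K2Lit.SiegelDoubled (tensorFrame tensorFrame_real tensorFrame_ne_zero IwasawaDatum)

namespace Summit.HodgeConjecture.HodgeConjecture.Cruxes.HLiu418.K2LiuArchGaussianOfRecord

variable (L : Type) [Field L] [NumberField L] [IsCMField L]

variable {N M n : ℕ} (e : Fin N × Fin M ≃ Fin n)
  (dV : Fin N → L) (hdV : ∀ i, IsCMField.complexConj L (dV i) = dV i) (hdV0 : ∀ i, dV i ≠ 0)
  (dW : Fin M → L) (hdW : ∀ i, IsCMField.complexConj L (dW i) = dW i) (hdW0 : ∀ i, dW i ≠ 0)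

/-! ## §1 The archimedean Gaussian `v_G` of a doubled datum and the hol-cut `HL_rec` -/

section Generic

/-- **`v_G` — the archimedean GAUSSIAN of the doubled Weil representation of the datum `(e, dV, dW)`**: the Folland–Fock vacuum `h₀ ∘ frameD` of
`𝓢((L⁺ ⊗ ℝ)^{n+n})`, `frameD` the scaled Folland frame of the doubled archimedean space in the `cmPlaceOver` sign conventions (★ `GRConstruction.frameD`, the frame in which
★ `archHalfOf` ∕ ★ `sD_archToAdelic_eq_archHalfOf` read every `χ`-normalised doubled Weil representation).  It is the vector written BY VALUE as `follandHermite (frameD …) 0` in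
★ `omega_archHalfOf_gaussian_tmul`. [cite: Folland1989, §1.7 (1.81), §4.2 Prop. (4.39)] [cite: GelbartRogawski1991, §3.1 Prop. 3.1.1 p. 455] -/
def archGaussian : 𝓢((Fin (n + n) → mixedSpace (Fp L)), ℂ) := follandHermite (frameD L e dV hdV hdV0 dW hdW hdW0) 0

/-- `v_G = follandHermite frameD 0` (definitional). [cite: Folland1989, §1.7 (1.81)] -/
theorem archGaussian_eq_follandHermite :
    archGaussian L e dV hdV hdV0 dW hdW hdW0 = follandHermite (frameD L e dV hdV hdV0 dW hdW hdW0) 0 := rfl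

/-- **`HL_rec` — THE HOL-CUT OF RECORD on a finite-dimensional archimedean type `V₀ ⊆ 𝓢((L⁺ ⊗ ℝ)^{n+n})`: `V₀` IS THE GAUSSIAN LINE `ℂ ∙ v_G`**
(RULING M-158n (Q1): the cut constrains `V₀` itself; ED. 7's `HL` is instantiated by this predicate at the tie). [cite: Liu2021, App. B proof of Prop. B.8 pp. 103–106]
[cite: Folland1989, §4.2 Prop. (4.39)] -/
def HLrec (V₀ : Submodule ℂ 𝓢((Fin (n + n) → mixedSpace (Fp L)), ℂ)) : Prop :=
  V₀ = ℂ ∙ archGaussian L e dV hdV hdV0 dW hdW hdW0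

variable {V₀ : Submodule ℂ 𝓢((Fin (n + n) → mixedSpace (Fp L)), ℂ)}

/-- `HL_rec V₀ ↔ V₀ = ℂ ∙ v_G` (definitional). [cite: Liu2021, App. B proof of Prop. B.8 pp. 103–106] -/
theorem hLrec_iff : HLrec L e dV hdV hdV0 dW hdW hdW0 V₀ ↔ V₀ = ℂ ∙ archGaussian L e dV hdV hdV0 dW hdW hdW0 := Iff.rfl

/-- the Gaussian line satisfies the cut. [cite: Liu2021, App. B proof of Prop. B.8 pp. 103–106] -/
theorem hLrec_span : HLrec L e dV hdV hdV0 dW hdW hdW0 (ℂ ∙ archGaussian L e dV hdV hdV0 dW hdW hdW0) := rfl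

end Generic

/-! ## §2 The #42F′ instance: the Gaussian of the BIG doubled datum `(e′, dV, dW ⊗ dV′)` and `HL_rec` of record -/

section OfRecord

variable {M₂ M' n' : ℕ} (eW : Fin M × Fin M₂ ≃ Fin M') (e' : Fin N × Fin M' ≃ Fin n')
  (dV' : Fin M₂ → L) (hdV' : ∀ k, IsCMField.complexConj L (dV' k) = dV' k) (hdV'0 : ∀ k, dV' k ≠ 0)

/-- **`v_G` OF RECORD for #42F′**: the archimedean Gaussian of the BIG doubled Weil representation `ω_{χb}` of the dual pair `(U(𝔻), U(V′))`, i.e. `archGaussian` at the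
doubled datum `(e′, dV, dW ⊗ dV′)` of ★ `K2Lit.DoubledTensorEmbedding` (`tensorFrame L dW eW dV′`) — a vector of `𝓢((Fin (n′+n′) → L⁺ ⊗ ℝ), ℂ)`, the carrier of ★ p862586's
`V : Submodule ℂ 𝓢(…)`. [cite: Kudla1994, §2, §3 Thm. 3.1] [cite: Folland1989, §1.7 (1.81)] -/
abbrev archGaussianOfRecord : 𝓢((Fin (n' + n') → mixedSpace (Fp L)), ℂ) :=
  archGaussian L e' dV hdV hdV0 (tensorFrame L dW eW dV') (tensorFrame_real L dW hdW eW dV' hdV')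
    (tensorFrame_ne_zero L dW eW dV' hdW0 hdV'0)

/-- byte guard: `v_G` of record IS `follandHermite (frameD …) 0` at the BIG doubled datum `(e′, dV, dW ⊗ dV′)` — the vector of ★ `omega_archHalfOf_gaussian_tmul` there (`rfl`).
[cite: Folland1989, §1.7 (1.81)] [cite: Kudla1994, §2, §3 Thm. 3.1] -/
theorem archGaussianOfRecord_eq_follandHermite :
    archGaussianOfRecord L dV hdV hdV0 dW hdW hdW0 eW e' dV' hdV' hdV'0 =
      follandHermite (frameD L e' dV hdV hdV0 (tensorFrame L dW eW dV') (tensorFrame_real L dW hdW eW dV' hdV')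
        (tensorFrame_ne_zero L dW eW dV' hdW0 hdV'0)) 0 := rfl

/-- **`HL_rec` OF RECORD for #42F′**: `V₀ = ℂ ∙ v_G` at the BIG doubled datum — the predicate ED. 7's `HL` is instantiated with
(`HL := fun L _ _ _ … eW e′ dV′ hdV′ … _𝒦 V₀ => HLrecOfRecord … V₀`). [cite: Liu2021, App. B proof of Prop. B.8 pp. 103–106] -/
abbrev HLrecOfRecord (V₀ : Submodule ℂ 𝓢((Fin (n' + n') → mixedSpace (Fp L)), ℂ)) : Prop :=
  HLrec L e' dV hdV hdV0 (tensorFrame L dW eW dV') (tensorFrame_real L dW hdW eW dV' hdV') (tensorFrame_ne_zero L dW eW dV' hdW0 hdV'0) V₀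

/-- `HL_rec` of record unfolds to `V₀ = ℂ ∙ v_G` of record (definitional). [cite: Liu2021, App. B proof of Prop. B.8 pp. 103–106] -/
theorem hLrecOfRecord_iff (V₀ : Submodule ℂ 𝓢((Fin (n' + n') → mixedSpace (Fp L)), ℂ)) :
    HLrecOfRecord L dV hdV hdV0 dW hdW hdW0 eW e' dV' hdV' hdV'0 V₀ ↔
      V₀ = ℂ ∙ archGaussianOfRecord L dV hdV hdV0 dW hdW hdW0 eW e' dV' hdV' hdV'0 := Iff.rfl

/-- the Gaussian line of record satisfies the cut of record. [cite: Liu2021, App. B proof of Prop. B.8 pp. 103–106] -/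
theorem hLrecOfRecord_span :
    HLrecOfRecord L dV hdV hdV0 dW hdW hdW0 eW e' dV' hdV' hdV'0 (ℂ ∙ archGaussianOfRecord L dV hdV hdV0 dW hdW hdW0 eW e' dV' hdV' hdV'0) := rfl

/-- **THE TIE-READY HOL-CUT OF RECORD** (RULING M-158p (1): «`HL` takes the FULL face prefix … same list in LH7-p05's `HL_rec` def»): the #42F′ face prefix
`(L) … {n} (e) (dV) (hdV) (hdV0) (dW) (hdW) (hdW0) (lam) (hlam) {M′ n′} (eW) (e′) (dV′) (hdV′) (hdV′0) (χb) (hχbu) (hχbs) (α) (hα) (hαrat) (𝒦)` of ★ p862586 :96–108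
VERBATIM, then `V₀ ↦ HLrecOfRecord … V₀`.  The vacuum vector depends on NONE of `e, lam, hlam, χb, hχbu, hχbs, α, hα, hαrat, 𝒦` (over-supply, `_`-named); so
`HL := holCutOfRecord` at the tie when ED. 7's `HL` has this ∀-list, else `HL := fun … => HLrecOfRecord …`. [cite: Liu2021, App. B proof of Prop. B.8 pp. 103–106] -/
abbrev holCutOfRecord (L : Type) [Field L] [NumberField L] [IsCMField L] {n : ℕ} (_e : Fin 2 × Fin 1 ≃ Fin n)
    (dV : Fin 2 → L) (hdV : ∀ i, IsCMField.complexConj L (dV i) = dV i) (hdV0 : ∀ i, dV i ≠ 0)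
    (dW : Fin 1 → L) (hdW : ∀ i, IsCMField.complexConj L (dW i) = dW i) (hdW0 : ∀ i, dW i ≠ 0)
    (_lam : Literature.NumberTheory.Automorphic.IdeleClassGroup L →ₜ* Circle) (_hlam : IsConjugateSymplectic L _lam)
    {M' n' : ℕ} (eW : Fin 1 × Fin 3 ≃ Fin M') (e' : Fin 2 × Fin M' ≃ Fin n')
    (dV' : Fin 3 → L) (hdV' : ∀ k, IsCMField.complexConj L (dV' k) = dV' k) (hdV'0 : ∀ k, dV' k ≠ 0)
    (_χb : HeckeCharacter L) (_hχbu : _χb.IsUnitary) (_hχbs : Literature.RepresentationTheory.HarrisKudlaSweet1996.IsSplittingChar L 1 _χb)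
    (_α : UnitaryGroup.adelicOne (Fp L) L (IsCMField.complexConj L) →* ℂˣ) (_hα : Continuous _α)
    (_hαrat : ∀ u : UnitaryGroup.adelicOne (Fp L) L (IsCMField.complexConj L),
      (u : Literature.NumberTheory.GaloisRepresentations.ideleGroup L) ∈ Literature.NumberTheory.GaloisRepresentations.principalIdeles L → _α u = 1)
    (_𝒦 : IwasawaDatum L _e dV hdV dW hdW)
    (V₀ : Submodule ℂ 𝓢((Fin (n' + n') → mixedSpace (Fp L)), ℂ)) : Prop :=
  HLrecOfRecord L dV hdV hdV0 dW hdW hdW0 eW e' dV' hdV' hdV'0 V₀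

/-- byte guard: the tie-ready cut unfolds to `V₀ = ℂ ∙ v_G` of record (`Iff.rfl`). [cite: Liu2021, App. B proof of Prop. B.8 pp. 103–106] -/
theorem holCutOfRecord_iff (L : Type) [Field L] [NumberField L] [IsCMField L] {n : ℕ} (e : Fin 2 × Fin 1 ≃ Fin n)
    (dV : Fin 2 → L) (hdV : ∀ i, IsCMField.complexConj L (dV i) = dV i) (hdV0 : ∀ i, dV i ≠ 0)
    (dW : Fin 1 → L) (hdW : ∀ i, IsCMField.complexConj L (dW i) = dW i) (hdW0 : ∀ i, dW i ≠ 0)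
    (lam : Literature.NumberTheory.Automorphic.IdeleClassGroup L →ₜ* Circle) (hlam : IsConjugateSymplectic L lam)
    {M' n' : ℕ} (eW : Fin 1 × Fin 3 ≃ Fin M') (e' : Fin 2 × Fin M' ≃ Fin n')
    (dV' : Fin 3 → L) (hdV' : ∀ k, IsCMField.complexConj L (dV' k) = dV' k) (hdV'0 : ∀ k, dV' k ≠ 0)
    (χb : HeckeCharacter L) (hχbu : χb.IsUnitary) (hχbs : Literature.RepresentationTheory.HarrisKudlaSweet1996.IsSplittingChar L 1 χb)
    (α : UnitaryGroup.adelicOne (Fp L) L (IsCMField.complexConj L) →* ℂˣ) (hα : Continuous α)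
    (hαrat : ∀ u : UnitaryGroup.adelicOne (Fp L) L (IsCMField.complexConj L),
      (u : Literature.NumberTheory.GaloisRepresentations.ideleGroup L) ∈ Literature.NumberTheory.GaloisRepresentations.principalIdeles L → α u = 1)
    (𝒦 : IwasawaDatum L e dV hdV dW hdW)
    (V₀ : Submodule ℂ 𝓢((Fin (n' + n') → mixedSpace (Fp L)), ℂ)) :
    holCutOfRecord L e dV hdV hdV0 dW hdW hdW0 lam hlam eW e' dV' hdV' hdV'0 χb hχbu hχbs α hα hαrat 𝒦 V₀ ↔
      V₀ = ℂ ∙ archGaussianOfRecord L dV hdV hdV0 dW hdW hdW0 eW e' dV' hdV' hdV'0 := Iff.rfl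

end OfRecord

end Summit.HodgeConjecture.HodgeConjecture.Cruxes.HLiu418.K2LiuArchGaussianOfRecord

end
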